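import Summits.ValiantsHypothesis.ValiantsHypothesis.Theorems.LangWeilTransferTameResolutionParamExplicit
import Literature.RingTheory.NoetherNormalization.HypersurfaceModel
import Literature.Computability.AlgebraicComplexity.BurgisserBooleanPartsA3Assembly

/-!
# LangWeilTransfer, support item `TameResolution` (stmt-ValiantsHypothesis-6378) — a
# transcendence basis AMONG THE COORDINATES and the variable split it induces

Route `LangWeilTransfer` of `ValiantsHypothesis` (conditional route; honest framing: bookkeeping,
nothing here bears on VP ≠ VNP, which is NOT proved). Step (3) of the Noether-free quantitative
assembly of `TameResolution` (val-width-6373-p2 g2). For a prime `𝔭 ⊂ ℚ[Y_1, …, Y_m]` the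
function field `Frac(ℚ[Y]/𝔭)` is generated by the coordinate functions, so (characteristic `0`)
some SUBSET of the coordinates is a transcendence basis
(`Literature.RingTheory.NoetherNormalization.exists_finset_isTranscendenceBasis_and_isSeparable_of_perfectField`).
Indexing it by `Fin r` and its complement by `Fin n` gives an equivalence
`e : Fin n ⊕ Fin r ≃ Fin m` and the SPLIT isomorphism
`Γ = sumAlgEquiv ∘ rename e⁻¹ : ℤ[Y] ≃ ℤ[T][X]` (`X_j = Y_{e(inl j)}`, `T_k = Y_{e(inr k)}`):
no shears, no heights — `Γ` is a relabelling of monomials, so it does not increase the outer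
(`X`-)degree, the inner (`T`-)degree of any coefficient, or the sum of the weights of the
`T`-coefficients (`= weight`, the sum of the absolute values of the integer coefficients).

* `totalDegree_coeff_sumAlgEquiv_le`, `sum_weight_coeff_sumAlgEquiv_le` — inner sizes of a split
  polynomial;
* `exists_coordinate_split` — the package consumed by the assembly.
-/

noncomputable section

open MvPolynomial
open Literature.Computability.AlgebraicComplexity (weight)

-- the summit and the problem share the name `ValiantsHypothesis` (D-0017 single-conjunct layout)
set_option linter.dupNamespace false

namespace Summit.ValiantsHypothesis.ValiantsHypothesis.Theorems.LangWeilTransfer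

/-! ## Inner sizes under `sumAlgEquiv` -/

section Split

variable {S₁ S₂ : Type*} [Fintype S₁] [Fintype S₂]

/-- `sumAlgEquiv` on a monomial: the monomial splits into its `S₁`-part (outer) and its
`S₂`-part (inner, carrying the coefficient). -/
theorem sumAlgEquiv_monomial {R : Type*} [CommRing R] (μ : S₁ ⊕ S₂ →₀ ℕ) (c : R) :
    sumAlgEquiv R S₁ S₂ (monomial μ c) =
      monomial (Finsupp.sumFinsuppAddEquivProdFinsupp μ).1
        (monomial (Finsupp.sumFinsuppAddEquivProdFinsupp μ).2 c) := by
  classical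
  have hC : sumAlgEquiv R S₁ S₂ (C c) = C (C c) := by simp
  rw [monomial_eq, monomial_eq, monomial_eq, Finsupp.prod_fintype _ _ (fun _ => pow_zero _),
    Finsupp.prod_fintype _ _ (fun _ => pow_zero _), Finsupp.prod_fintype _ _ (fun _ => pow_zero _),
    Fintype.prod_sum_type, map_mul, map_mul, map_prod, map_prod, hC]
  simp only [map_pow, sumAlgEquiv_X_inl, sumAlgEquiv_X_inr, Finsupp.fst_sumFinsuppAddEquivProdFinsupp,
    Finsupp.snd_sumFinsuppAddEquivProdFinsupp, map_mul, map_prod]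
  ring

/-- The degree of the inner part of an exponent vector is at most its total degree. -/
theorem sum_snd_sumFinsuppAddEquivProdFinsupp_le (μ : S₁ ⊕ S₂ →₀ ℕ) :
    ((Finsupp.sumFinsuppAddEquivProdFinsupp μ).2.sum fun _ e => e) ≤ μ.sum fun _ e => e := by
  rw [Finsupp.sum_fintype _ _ (fun _ => rfl), Finsupp.sum_fintype _ _ (fun _ => rfl), Fintype.sum_sum_type]
  simp only [Finsupp.snd_sumFinsuppAddEquivProdFinsupp]
  exact Nat.le_add_left _ _

/-- **Inner degrees.** Every `T`-coefficient of the split polynomial has total degree at most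
the total degree of the original. -/
theorem totalDegree_coeff_sumAlgEquiv_le {R : Type*} [CommRing R] (f : MvPolynomial (S₁ ⊕ S₂) R)
    (β : S₁ →₀ ℕ) : ((sumAlgEquiv R S₁ S₂ f).coeff β).totalDegree ≤ f.totalDegree := by
  classical
  conv_lhs => rw [f.as_sum]
  rw [map_sum, coeff_sum]
  refine totalDegree_finsetSum_le fun μ hμ => ?_
  rw [sumAlgEquiv_monomial, coeff_monomial]
  split_ifs with h
  · refine (totalDegree_monomial_le _ _).trans ?_
    exact (sum_snd_sumFinsuppAddEquivProdFinsupp_le μ).trans (le_totalDegree hμ)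
  · rw [totalDegree_zero]; exact Nat.zero_le _

/-- The weight of an inner monomial coefficient. -/
theorem weight_coeff_sumAlgEquiv_monomial [DecidableEq S₁] (μ : S₁ ⊕ S₂ →₀ ℕ) (c : ℤ) (β : S₁ →₀ ℕ) :
    weight ((sumAlgEquiv ℤ S₁ S₂ (monomial μ c)).coeff β) ≤
      if (Finsupp.sumFinsuppAddEquivProdFinsupp μ).1 = β then c.natAbs else 0 := by
  rw [sumAlgEquiv_monomial, coeff_monomial]
  split_ifs with h
  · rw [Literature.Computability.AlgebraicComplexity.weight_monomial]
  · rw [Literature.Computability.AlgebraicComplexity.weight_zero]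

/-- **Inner weights.** The sum over the outer monomials of the weights of the `T`-coefficients
of the split polynomial is at most the weight of the original (in fact equal). -/
theorem sum_weight_coeff_sumAlgEquiv_le (f : MvPolynomial (S₁ ⊕ S₂) ℤ) :
    ((sumAlgEquiv ℤ S₁ S₂ f).support.sum fun β => weight ((sumAlgEquiv ℤ S₁ S₂ f).coeff β)) ≤ weight f := by
  classical
  set g := sumAlgEquiv ℤ S₁ S₂ f with hg
  set πl : (S₁ ⊕ S₂ →₀ ℕ) → (S₁ →₀ ℕ) := fun μ => (Finsupp.sumFinsuppAddEquivProdFinsupp μ).1 with hπl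
  -- coefficientwise bound by the fibre sums
  have hcoeff : ∀ β, weight (g.coeff β) ≤ ∑ μ ∈ f.support with πl μ = β, (f.coeff μ).natAbs := by
    intro β
    have hsum : g.coeff β = ∑ μ ∈ f.support, (sumAlgEquiv ℤ S₁ S₂ (monomial μ (f.coeff μ))).coeff β := by
      rw [hg]
      conv_lhs => rw [f.as_sum]
      rw [map_sum, coeff_sum]
    rw [hsum, Finset.sum_filter]
    refine (Literature.Computability.AlgebraicComplexity.weight_finset_sum_le _ _).trans ?_
    exact Finset.sum_le_sum fun μ _ => weight_coeff_sumAlgEquiv_monomial μ (f.coeff μ) β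
  have hfib : ∑ β ∈ g.support, ∑ μ ∈ f.support with πl μ = β, (f.coeff μ).natAbs =
      ∑ μ ∈ f.support with πl μ ∈ g.support, (f.coeff μ).natAbs := by
    rw [← Finset.sum_fiberwise_of_maps_to (s := f.support.filter fun μ => πl μ ∈ g.support) (t := g.support)
      (g := πl) (fun μ hμ => (Finset.mem_filter.1 hμ).2) (f := fun μ => (f.coeff μ).natAbs)]
    refine Finset.sum_congr rfl fun β hβ => Finset.sum_congr ?_ fun _ _ => rfl
    rw [Finset.filter_filter]
    refine Finset.filter_congr fun μ _ => ?_
    constructor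
    · intro h3; exact ⟨h3 ▸ hβ, h3⟩
    · rintro ⟨_, h3⟩; exact h3
  calc ∑ β ∈ g.support, weight (g.coeff β)
      ≤ ∑ β ∈ g.support, ∑ μ ∈ f.support with πl μ = β, (f.coeff μ).natAbs :=
        Finset.sum_le_sum fun β _ => hcoeff β
    _ = ∑ μ ∈ f.support with πl μ ∈ g.support, (f.coeff μ).natAbs := hfib
    _ ≤ ∑ μ ∈ f.support, (f.coeff μ).natAbs := Finset.sum_le_sum_of_subset (Finset.filter_subset _ _)
    _ = weight f := rfl

end Split

/-! ## The coordinate split of a prime of `ℚ[Y]` -/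

open Literature.RingTheory.NoetherNormalization in
/-- **Transcendence basis among the coordinates and the induced split.** For a prime
`𝔭 ⊂ ℚ[Y_1..Y_m]` there are `n + r = m`, an equivalence `e : Fin n ⊕ Fin r ≃ Fin m` such that the
coordinate functions `y_{e(inr k)}` form a transcendence basis of `Frac(ℚ[Y]/𝔭)` over `ℚ`, and the
split isomorphism `Γ : ℤ[Y] ≃ ℤ[T][X]` with `Γ(Y_{e(inl j)}) = X_j`, `Γ(Y_{e(inr k)}) = T_k`, which
does not increase outer degrees, inner degrees, or the total weight of the inner coefficients. -/
theorem exists_coordinate_split {m : ℕ} (𝔭 : Ideal (MvPolynomial (Fin m) ℚ)) [𝔭.IsPrime] :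
    ∃ (r n : ℕ) (e : Fin n ⊕ Fin r ≃ Fin m)
      (Γ : MvPolynomial (Fin m) ℤ ≃+* MvPolynomial (Fin n) (MvPolynomial (Fin r) ℤ)),
      n + r = m ∧ IsTranscendenceBasis ℚ (fun k => xF 𝔭 (e (Sum.inr k))) ∧
      (∀ j, Γ (X (e (Sum.inl j))) = X j) ∧ (∀ k, Γ (X (e (Sum.inr k))) = C (X k)) ∧
      (∀ f, (Γ f).totalDegree ≤ f.totalDegree) ∧
      (∀ f β, ((Γ f).coeff β).totalDegree ≤ f.totalDegree) ∧
      (∀ f, ((Γ f).support.sum fun β => weight ((Γ f).coeff β)) ≤ weight f) := by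
  classical
  obtain ⟨s, hs, -⟩ := exists_finset_isTranscendenceBasis_and_isSeparable_of_perfectField
    (k := ℚ) (xF 𝔭) (adjoin_range_xF_eq_top 𝔭)
  -- index the basis by `Fin r` and the complement by `Fin n`
  let R' := {i : Fin m // i ∈ s}
  let N' := {i : Fin m // i ∉ s}
  let r := Fintype.card R'
  let n := Fintype.card N'
  let eR : Fin r ≃ R' := (Fintype.equivFin R').symm
  let eN : Fin n ≃ N' := (Fintype.equivFin N').symm
  let e : Fin n ⊕ Fin r ≃ Fin m :=
    ((Equiv.sumCongr eN eR).trans (Equiv.sumComm _ _)).trans (Equiv.sumCompl fun i : Fin m => i ∈ s)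
  have hnr : n + r = m := by
    have h := Fintype.card_congr e
    simp only [Fintype.card_sum, Fintype.card_fin] at h
    exact h
  -- the split isomorphism
  let Γa : MvPolynomial (Fin m) ℤ ≃ₐ[ℤ] MvPolynomial (Fin n) (MvPolynomial (Fin r) ℤ) :=
    (renameEquiv ℤ e.symm).trans (sumAlgEquiv ℤ (Fin n) (Fin r))
  have hΓa : ∀ f, Γa f = sumAlgEquiv ℤ (Fin n) (Fin r) (rename e.symm f) := fun f => rfl
  refine ⟨r, n, e, Γa.toRingEquiv, hnr, ?_, fun j => ?_, fun k => ?_, fun f => ?_, fun f β => ?_, fun f => ?_⟩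
  · -- transcendence basis, reindexed
    exact hs.comp_equiv eR
  · change Γa (X (e (Sum.inl j))) = X j
    rw [hΓa, rename_X, Equiv.symm_apply_apply, sumAlgEquiv_X_inl]
  · change Γa (X (e (Sum.inr k))) = C (X k)
    rw [hΓa, rename_X, Equiv.symm_apply_apply, sumAlgEquiv_X_inr]
  · change (Γa f).totalDegree ≤ f.totalDegree
    rw [hΓa]
    exact (totalDegree_sumAlgEquiv_le _).trans (totalDegree_rename_le _ _)
  · change ((Γa f).coeff β).totalDegree ≤ f.totalDegree
    rw [hΓa]
    exact (totalDegree_coeff_sumAlgEquiv_le _ β).trans (totalDegree_rename_le _ _)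
  · change ((Γa f).support.sum fun β => weight ((Γa f).coeff β)) ≤ weight f
    rw [hΓa, ← Literature.Computability.AlgebraicComplexity.weight_rename_of_injective e.symm.injective f]
    exact sum_weight_coeff_sumAlgEquiv_le _

end Summit.ValiantsHypothesis.ValiantsHypothesis.Theorems.LangWeilTransfer

end
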